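import Summits.PneNP.PneNP.Theorems.ChebyshevTracialDesignTightLinks
import HarnessLib

/-!
# Cell pnp-psdrank, route `ChebyshevTracialDesign`: the FOUR-CELL IDENTITIES of the crossing count and the GENERAL LINK
# IDENTITY for two cuts at any Johnson distance (crux `TracialDecayExp20`, stmt-PneNP-19878)

Engine brick (eng g15, MEMO-15 (eng) §2.1). For a perfect matching `M` and two vertex sets `X`, `Y` write the four cells
`A = X ∩ Y`, `B₁ = X ∖ Y`, `B₂ = Y ∖ X`, `R = (X ∪ Y)ᶜ`. The crossing count `cc(·, M) = |δ(·) ∩ M|` satisfies the two exact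
four-cell identities (true edge by edge for ANY set of pairs `M`, no matching hypothesis):
* `cc(X) + cc(Y) = cc(X ∩ Y) + cc(X ∪ Y) + 2·e_M(X ∖ Y, Y ∖ X)` (submodularity of the cut function with its correction term),
* `cc(X) + cc(Y) = cc(X ∖ Y) + cc(Y ∖ X) + 2·e_M(X ∩ Y, (X ∪ Y)ᶜ)` (the 'posimodular' companion),
where `e_M(S, T)` = number of pairs of `M` joining the disjoint sets `S` and `T`, written without new definitions as
`#{e ∈ M : e crosses S ∧ e crosses T}` (for disjoint `S`, `T` a pair crosses both iff it joins them; for the second identity a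
pair crosses `X ∩ Y` and `X ∪ Y` iff it joins `X ∩ Y` to the complement of `X ∪ Y`).
Consequence (parity: an even set is crossed an even number of times by a perfect matching): **the general link identity** —
if `U₁`, `U₂` are both TIGHT for `M` (`cc = 1`) then
* when `|U₁ ∩ U₂|` and `|U₁ ∪ U₂|` are even (for odd cuts: odd Johnson distance `s = |U₁ ∖ U₂|`), `M` SPLITS ALONG `U₁ ∩ U₂` OR ALONG
  `U₁ ∪ U₂` (`cc = 0`), i.e. `T(U₁) ∩ T(U₂) ⊆ Z(U₁ ∩ U₂) ∪ Z(U₁ ∪ U₂)` — brick 71's `cc_and_cc_iff_of_adjacent` is the case `s = 1`,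
  where the converse inclusion also holds;
* when `|U₁ ∖ U₂|` and `|U₂ ∖ U₁|` are even (even distance), `M` SPLITS ALONG `U₁ ∖ U₂` OR ALONG `U₂ ∖ U₁`.
So the common tight matchings of ANY two cuts live over the two even cells among `{U₁ ∩ U₂, U₁ ∖ U₂, U₂ ∖ U₁, U₁ ∪ U₂}`, the
non-adjacent form of the biclique skeleton (MEMO-16 §1, §6(b): the robust `r = 3` programme runs on non-adjacent pairs).
§1 generic vertex type; §2 the kernel's currency `OddSet n`, `PMatch n`, `cc`, with the parities derived from `|U₁ ∖ U₂|`;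
§3 (appended) the counted trichotomies at even distance and in the kernel's currency.
[cite: Rothvoss2017, §2 (PDF pp. 5–6: `δ(U)`, `|δ(U) ∩ M|`, the tight pairs `Q_1`, "for parity reasons")]
Stature: support/instrument (elementary double counting). WHAT THIS IS NOT: no value bound, no mass statement for
`T(U₁) ∩ T(U₂)` (the PairSNT₁ of MEMO-16 §6(b) is analytic), nothing on psd rank of P_PM(K_n), no P-vs-NP content.
-/

set_option linter.dupNamespace false -- `Summit.PneNP.PneNP.…`: summit = sub-problem (D-0017)

noncomputable section

namespace Summit.PneNP.PneNP.Theorems.ChebyshevTracialDesignCutPairLinks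

open Finset Literature.Barriers.PneNP
open Literature.Combinatorics.SimpleGraph.CycleSpace
open Literature.Combinatorics.AssociationSchemes.CutMatchingRestriction

/-! ### §1 Generic vertex type: four-cell identities, parity, the general link identity -/

section Generic

variable {α : Type*} [DecidableEq α]

/-- The crossing count as a sum of indicators. [cite: Rothvoss2017, §2 (PDF p. 5: `|δ(U) ∩ M|`)] -/
theorem crossCount_eq_sum_ite (U : Finset α) (M : Finset (Sym2 α)) :
    crossCount U M = ∑ e ∈ M, if Crosses U e then 1 else 0 := by
  unfold crossCount
  rw [card_filter]

/-- Edge-by-edge form of the first four-cell identity: for one pair `{a, b}`,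
`[crosses X] + [crosses Y] = [crosses X ∩ Y] + [crosses X ∪ Y] + 2·[crosses X ∖ Y and Y ∖ X]`.
[cite: Rothvoss2017, §2 (PDF p. 5: `δ(U)`)] -/
theorem crosses_ite_inter_union (X Y : Finset α) (e : Sym2 α) :
    (if Crosses X e then 1 else 0) + (if Crosses Y e then 1 else 0) =
      (if Crosses (X ∩ Y) e then 1 else 0) + (if Crosses (X ∪ Y) e then 1 else 0) +
        2 * (if Crosses (X \ Y) e ∧ Crosses (Y \ X) e then (1 : ℕ) else 0) := by
  induction e using Sym2.ind with
  | h a b =>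
    simp only [crosses_mk, mem_inter, mem_union, mem_sdiff]
    by_cases haX : a ∈ X <;> by_cases haY : a ∈ Y <;> by_cases hbX : b ∈ X <;> by_cases hbY : b ∈ Y <;>
      simp [haX, haY, hbX, hbY]

/-- Edge-by-edge form of the second four-cell identity: for one pair `{a, b}`,
`[crosses X] + [crosses Y] = [crosses X ∖ Y] + [crosses Y ∖ X] + 2·[crosses X ∩ Y and X ∪ Y]`.
[cite: Rothvoss2017, §2 (PDF p. 5: `δ(U)`)] -/
theorem crosses_ite_sdiff_sdiff (X Y : Finset α) (e : Sym2 α) :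
    (if Crosses X e then 1 else 0) + (if Crosses Y e then 1 else 0) =
      (if Crosses (X \ Y) e then 1 else 0) + (if Crosses (Y \ X) e then 1 else 0) +
        2 * (if Crosses (X ∩ Y) e ∧ Crosses (X ∪ Y) e then (1 : ℕ) else 0) := by
  induction e using Sym2.ind with
  | h a b =>
    simp only [crosses_mk, mem_inter, mem_union, mem_sdiff]
    by_cases haX : a ∈ X <;> by_cases haY : a ∈ Y <;> by_cases hbX : b ∈ X <;> by_cases hbY : b ∈ Y <;>
      simp [haX, haY, hbX, hbY]

/-- **First four-cell identity (submodularity of the crossing count with its correction term).** For every set of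
pairs `M` and all vertex sets `X`, `Y`:
`cc(X, M) + cc(Y, M) = cc(X ∩ Y, M) + cc(X ∪ Y, M) + 2·#{e ∈ M : e crosses X ∖ Y and Y ∖ X}`
(the last set is the set of pairs of `M` joining `X ∖ Y` to `Y ∖ X`). [cite: Rothvoss2017, §2 (PDF p. 5: `|δ(U) ∩ M|`)] -/
theorem crossCount_add_eq_inter_union (X Y : Finset α) (M : Finset (Sym2 α)) :
    crossCount X M + crossCount Y M =
      crossCount (X ∩ Y) M + crossCount (X ∪ Y) M + 2 * (M.filter fun e => Crosses (X \ Y) e ∧ Crosses (Y \ X) e).card := by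
  simp only [crossCount_eq_sum_ite, card_filter, mul_sum, ← sum_add_distrib]
  exact sum_congr rfl fun e _ => crosses_ite_inter_union X Y e

/-- **Second four-cell identity.** For every set of pairs `M` and all vertex sets `X`, `Y`:
`cc(X, M) + cc(Y, M) = cc(X ∖ Y, M) + cc(Y ∖ X, M) + 2·#{e ∈ M : e crosses X ∩ Y and X ∪ Y}`
(the last set is the set of pairs of `M` joining `X ∩ Y` to the complement of `X ∪ Y`).
[cite: Rothvoss2017, §2 (PDF p. 5: `|δ(U) ∩ M|`)] -/
theorem crossCount_add_eq_sdiff_sdiff (X Y : Finset α) (M : Finset (Sym2 α)) :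
    crossCount X M + crossCount Y M =
      crossCount (X \ Y) M + crossCount (Y \ X) M + 2 * (M.filter fun e => Crosses (X ∩ Y) e ∧ Crosses (X ∪ Y) e).card := by
  simp only [crossCount_eq_sum_ite, card_filter, mul_sum, ← sum_add_distrib]
  exact sum_congr rfl fun e _ => crosses_ite_sdiff_sdiff X Y e

/-- Submodularity of the crossing count: `cc(X ∩ Y) + cc(X ∪ Y) ≤ cc(X) + cc(Y)`.
[cite: Rothvoss2017, §2 (PDF p. 5: `|δ(U) ∩ M|`)] -/
theorem crossCount_inter_add_union_le (X Y : Finset α) (M : Finset (Sym2 α)) :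
    crossCount (X ∩ Y) M + crossCount (X ∪ Y) M ≤ crossCount X M + crossCount Y M := by
  have h := crossCount_add_eq_inter_union X Y M
  omega

/-- Posimodularity of the crossing count: `cc(X ∖ Y) + cc(Y ∖ X) ≤ cc(X) + cc(Y)`.
[cite: Rothvoss2017, §2 (PDF p. 5: `|δ(U) ∩ M|`)] -/
theorem crossCount_sdiff_add_sdiff_le (X Y : Finset α) (M : Finset (Sym2 α)) :
    crossCount (X \ Y) M + crossCount (Y \ X) M ≤ crossCount X M + crossCount Y M := by
  have h := crossCount_add_eq_sdiff_sdiff X Y M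
  omega

/-- **Parity.** An even subset of the vertex set is crossed an even number of times by every perfect matching.
[cite: Rothvoss2017, §2 (PDF p. 6: "for parity reasons")] -/
theorem even_crossCount {Ω U : Finset α} {M : Finset (Sym2 α)} (hM : IsPMOn Ω M) (hU : U ⊆ Ω) (heven : Even U.card) :
    Even (crossCount U M) := by
  have h1 := hM.card_eq_sum_cutCount hU
  rw [sum_cutCount_eq] at h1
  have h2 : (M.filter fun e => cutCount U e = 1) = M.filter (Crosses U) := filter_congr fun e _ => cutCount_eq_one_iff
  rw [h2] at h1
  unfold crossCount
  obtain ⟨k, hk⟩ := heven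
  exact ⟨k - (M.filter fun e => cutCount U e = 2).card, by omega⟩

/-- **General link identity, odd distance (generic).** If `U₁` and `U₂` are both tight for the perfect matching `M` of `Ω`
and the cells `U₁ ∩ U₂`, `U₁ ∪ U₂` are even, then `M` splits along `U₁ ∩ U₂` or along `U₁ ∪ U₂`:
`T(U₁) ∩ T(U₂) ⊆ Z(U₁ ∩ U₂) ∪ Z(U₁ ∪ U₂)`. (Submodularity gives `cc(U₁ ∩ U₂) + cc(U₁ ∪ U₂) ≤ 2`, and both counts are even.)
[cite: Rothvoss2017, §2 (PDF p. 6: the tight pairs `Q_1`)] -/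
theorem splits_inter_or_union_of_tight {Ω U₁ U₂ : Finset α} {M : Finset (Sym2 α)} (hM : IsPMOn Ω M) (h₁ : U₁ ⊆ Ω) (h₂ : U₂ ⊆ Ω)
    (hinter : Even (U₁ ∩ U₂).card) (hunion : Even (U₁ ∪ U₂).card)
    (ht₁ : crossCount U₁ M = 1) (ht₂ : crossCount U₂ M = 1) :
    crossCount (U₁ ∩ U₂) M = 0 ∨ crossCount (U₁ ∪ U₂) M = 0 := by
  have hle := crossCount_inter_add_union_le U₁ U₂ M
  obtain ⟨a, ha⟩ := even_crossCount hM (inter_subset_left.trans h₁) hinter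
  obtain ⟨b, hb⟩ := even_crossCount hM (union_subset h₁ h₂) hunion
  omega

/-- **General link identity, even distance (generic).** If `U₁` and `U₂` are both tight for the perfect matching `M` of `Ω`
and the cells `U₁ ∖ U₂`, `U₂ ∖ U₁` are even, then `M` splits along `U₁ ∖ U₂` or along `U₂ ∖ U₁`.
[cite: Rothvoss2017, §2 (PDF p. 6: the tight pairs `Q_1`)] -/
theorem splits_sdiff_or_sdiff_of_tight {Ω U₁ U₂ : Finset α} {M : Finset (Sym2 α)} (hM : IsPMOn Ω M) (h₁ : U₁ ⊆ Ω) (h₂ : U₂ ⊆ Ω)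
    (hsdiff₁ : Even (U₁ \ U₂).card) (hsdiff₂ : Even (U₂ \ U₁).card)
    (ht₁ : crossCount U₁ M = 1) (ht₂ : crossCount U₂ M = 1) :
    crossCount (U₁ \ U₂) M = 0 ∨ crossCount (U₂ \ U₁) M = 0 := by
  have hle := crossCount_sdiff_add_sdiff_le U₁ U₂ M
  obtain ⟨a, ha⟩ := even_crossCount hM (sdiff_subset.trans h₁) hsdiff₁
  obtain ⟨b, hb⟩ := even_crossCount hM (sdiff_subset.trans h₂) hsdiff₂
  omega

/-- In the odd-distance case the correction term is pinned too: if both cuts are tight and `U₁ ∩ U₂`, `U₁ ∪ U₂` are even,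
then EITHER `M` splits along both `U₁ ∩ U₂` and `U₁ ∪ U₂` and exactly one pair of `M` joins `U₁ ∖ U₂` to `U₂ ∖ U₁`, OR no pair of
`M` joins them and `cc(U₁ ∩ U₂, M) + cc(U₁ ∪ U₂, M) = 2` (one of the two being `0`). This is the three-piece partition of
`T(U₁) ∩ T(U₂)` of MEMO-15 (eng) §2.1 in counted form. [cite: Rothvoss2017, §2 (PDF p. 6: the tight pairs `Q_1`)] -/
theorem tight_tight_trichotomy {Ω U₁ U₂ : Finset α} {M : Finset (Sym2 α)} (hM : IsPMOn Ω M) (h₁ : U₁ ⊆ Ω) (h₂ : U₂ ⊆ Ω)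
    (hinter : Even (U₁ ∩ U₂).card) (hunion : Even (U₁ ∪ U₂).card)
    (ht₁ : crossCount U₁ M = 1) (ht₂ : crossCount U₂ M = 1) :
    (crossCount (U₁ ∩ U₂) M = 0 ∧ crossCount (U₁ ∪ U₂) M = 0 ∧
        (M.filter fun e => Crosses (U₁ \ U₂) e ∧ Crosses (U₂ \ U₁) e).card = 1) ∨
      ((M.filter fun e => Crosses (U₁ \ U₂) e ∧ Crosses (U₂ \ U₁) e).card = 0 ∧
        ((crossCount (U₁ ∩ U₂) M = 0 ∧ crossCount (U₁ ∪ U₂) M = 2) ∨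
          (crossCount (U₁ ∩ U₂) M = 2 ∧ crossCount (U₁ ∪ U₂) M = 0))) := by
  have heq := crossCount_add_eq_inter_union U₁ U₂ M
  obtain ⟨a, ha⟩ := even_crossCount hM (inter_subset_left.trans h₁) hinter
  obtain ⟨b, hb⟩ := even_crossCount hM (union_subset h₁ h₂) hunion
  omega

end Generic

/-! ### §2 The kernel's currency: `OddSet n`, `PMatch n`, `cc` -/

section Cuts

variable {n : ℕ}

/-- For two odd cuts, `|U₁ ∖ U₂|` odd makes `|U₁ ∩ U₂|` and `|U₁ ∪ U₂|` even. -/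
theorem even_inter_union_of_odd_sdiff (U₁ U₂ : OddSet n) (hs : Odd (U₁.1 \ U₂.1).card) :
    Even (U₁.1 ∩ U₂.1).card ∧ Even (U₁.1 ∪ U₂.1).card := by
  have e1 := card_sdiff_add_card_inter U₁.1 U₂.1
  have e2 := card_union_add_card_inter U₁.1 U₂.1
  have o1 := U₁.2
  have o2 := U₂.2
  rw [Nat.odd_iff] at hs o1 o2
  rw [Nat.even_iff, Nat.even_iff]
  omega

/-- For two odd cuts, `|U₁ ∖ U₂|` even makes `|U₂ ∖ U₁|` even as well. -/
theorem even_sdiff_of_even_sdiff (U₁ U₂ : OddSet n) (hs : Even (U₁.1 \ U₂.1).card) : Even (U₂.1 \ U₁.1).card := by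
  have e1 := card_sdiff_add_card_inter U₁.1 U₂.1
  have e2 := card_sdiff_add_card_inter U₂.1 U₁.1
  rw [inter_comm] at e2
  have o1 := U₁.2
  have o2 := U₂.2
  rw [Nat.odd_iff] at o1 o2
  rw [Nat.even_iff] at hs ⊢
  omega

/-- **General link identity for cuts at odd Johnson distance.** If `M` is tight with both `U₁` and `U₂` and `|U₁ ∖ U₂|` is
odd, then `M` splits along `U₁ ∩ U₂` or along `U₁ ∪ U₂`: `T(U₁) ∩ T(U₂) ⊆ Z(U₁ ∩ U₂) ∪ Z(U₁ ∪ U₂)` (brick 71's adjacent case is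
`|U₁ ∖ U₂| = 1`). [cite: Rothvoss2017, §2 (PDF p. 6: the tight pairs `Q_1`)] -/
theorem cc_splits_inter_or_union {U₁ U₂ : OddSet n} {M : PMatch n} (hs : Odd (U₁.1 \ U₂.1).card)
    (h₁ : cc U₁ M = 1) (h₂ : cc U₂ M = 1) :
    crossCount (U₁.1 ∩ U₂.1) M.1 = 0 ∨ crossCount (U₁.1 ∪ U₂.1) M.1 = 0 := by
  obtain ⟨hi, hu⟩ := even_inter_union_of_odd_sdiff U₁ U₂ hs
  rw [cc_eq_crossCount] at h₁ h₂
  exact splits_inter_or_union_of_tight M.2 (subset_univ _) (subset_univ _) hi hu h₁ h₂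

/-- **General link identity for cuts at even Johnson distance.** If `M` is tight with both `U₁` and `U₂` and `|U₁ ∖ U₂|` is
even, then `M` splits along `U₁ ∖ U₂` or along `U₂ ∖ U₁`. [cite: Rothvoss2017, §2 (PDF p. 6: the tight pairs `Q_1`)] -/
theorem cc_splits_sdiff_or_sdiff {U₁ U₂ : OddSet n} {M : PMatch n} (hs : Even (U₁.1 \ U₂.1).card)
    (h₁ : cc U₁ M = 1) (h₂ : cc U₂ M = 1) :
    crossCount (U₁.1 \ U₂.1) M.1 = 0 ∨ crossCount (U₂.1 \ U₁.1) M.1 = 0 := by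
  have hs₂ := even_sdiff_of_even_sdiff U₁ U₂ hs
  rw [cc_eq_crossCount] at h₁ h₂
  exact splits_sdiff_or_sdiff_of_tight M.2 (subset_univ _) (subset_univ _) hs hs₂ h₁ h₂

/-- **Dichotomy for any two cuts.** Every common tight matching of two odd cuts splits along one of the two even cells among
`U₁ ∩ U₂`, `U₁ ∪ U₂` (odd distance) or `U₁ ∖ U₂`, `U₂ ∖ U₁` (even distance). [cite: Rothvoss2017, §2 (PDF p. 6: the tight pairs `Q_1`)] -/
theorem cc_splits_of_tight_tight {U₁ U₂ : OddSet n} {M : PMatch n} (h₁ : cc U₁ M = 1) (h₂ : cc U₂ M = 1) :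
    (Odd (U₁.1 \ U₂.1).card ∧ (crossCount (U₁.1 ∩ U₂.1) M.1 = 0 ∨ crossCount (U₁.1 ∪ U₂.1) M.1 = 0)) ∨
      (Even (U₁.1 \ U₂.1).card ∧ (crossCount (U₁.1 \ U₂.1) M.1 = 0 ∨ crossCount (U₂.1 \ U₁.1) M.1 = 0)) := by
  rcases Nat.even_or_odd (U₁.1 \ U₂.1).card with he | ho
  · exact Or.inr ⟨he, cc_splits_sdiff_or_sdiff he h₁ h₂⟩
  · exact Or.inl ⟨ho, cc_splits_inter_or_union ho h₁ h₂⟩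

/-- Submodularity in the kernel's currency: `cc(U₁ ∩ U₂) + cc(U₁ ∪ U₂) ≤ cc U₁ + cc U₂` for the crossing counts of any perfect
matching. [cite: Rothvoss2017, §2 (PDF p. 5: `|δ(U) ∩ M|`)] -/
theorem crossCount_inter_add_union_le_cc (U₁ U₂ : OddSet n) (M : PMatch n) :
    crossCount (U₁.1 ∩ U₂.1) M.1 + crossCount (U₁.1 ∪ U₂.1) M.1 ≤ cc U₁ M + cc U₂ M := by
  rw [cc_eq_crossCount, cc_eq_crossCount]
  exact crossCount_inter_add_union_le _ _ _

end Cuts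

/-! ### §3 Even distance: the counted trichotomy, and the two trichotomies in the kernel's currency (appended, eng g15) -/

section Trichotomy

variable {α : Type*} [DecidableEq α]

/-- In the even-distance case the correction term is pinned too: if both cuts are tight and `U₁ ∖ U₂`, `U₂ ∖ U₁` are even, then EITHER `M`
splits along both `U₁ ∖ U₂` and `U₂ ∖ U₁` and exactly one pair of `M` joins `U₁ ∩ U₂` to the complement of `U₁ ∪ U₂`, OR no pair of `M` does
and `(cc(U₁ ∖ U₂, M), cc(U₂ ∖ U₁, M)) ∈ {(0,2), (2,0)}` — the three-piece partition of `T(U₁) ∩ T(U₂)` at even distance in counted form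
(MEMO-15 (eng) §2.1). [cite: Rothvoss2017, §2 (PDF p. 6: the tight pairs `Q_1`)] -/
theorem tight_tight_trichotomy_even {Ω U₁ U₂ : Finset α} {M : Finset (Sym2 α)} (hM : IsPMOn Ω M) (h₁ : U₁ ⊆ Ω) (h₂ : U₂ ⊆ Ω)
    (hsdiff₁ : Even (U₁ \ U₂).card) (hsdiff₂ : Even (U₂ \ U₁).card)
    (ht₁ : crossCount U₁ M = 1) (ht₂ : crossCount U₂ M = 1) :
    (crossCount (U₁ \ U₂) M = 0 ∧ crossCount (U₂ \ U₁) M = 0 ∧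
        (M.filter fun e => Crosses (U₁ ∩ U₂) e ∧ Crosses (U₁ ∪ U₂) e).card = 1) ∨
      ((M.filter fun e => Crosses (U₁ ∩ U₂) e ∧ Crosses (U₁ ∪ U₂) e).card = 0 ∧
        ((crossCount (U₁ \ U₂) M = 0 ∧ crossCount (U₂ \ U₁) M = 2) ∨
          (crossCount (U₁ \ U₂) M = 2 ∧ crossCount (U₂ \ U₁) M = 0))) := by
  have heq := crossCount_add_eq_sdiff_sdiff U₁ U₂ M
  obtain ⟨a, ha⟩ := even_crossCount hM (sdiff_subset.trans h₁) hsdiff₁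
  obtain ⟨b, hb⟩ := even_crossCount hM (sdiff_subset.trans h₂) hsdiff₂
  omega

variable {n : ℕ}

/-- **Counted trichotomy at odd Johnson distance, `K_n` currency.** For two odd cuts with `|U₁ ∖ U₂|` odd and a perfect matching tight with both:
either `M` splits along `U₁ ∩ U₂` and along `U₁ ∪ U₂` with exactly one edge joining `U₁ ∖ U₂` to `U₂ ∖ U₁`, or there is no such edge and
`(cc(U₁ ∩ U₂), cc(U₁ ∪ U₂)) ∈ {(0,2),(2,0)}`. [cite: Rothvoss2017, §2 (PDF p. 6: the tight pairs `Q_1`)] -/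
theorem cc_trichotomy_odd {U₁ U₂ : OddSet n} {M : PMatch n} (hs : Odd (U₁.1 \ U₂.1).card) (h₁ : cc U₁ M = 1) (h₂ : cc U₂ M = 1) :
    (crossCount (U₁.1 ∩ U₂.1) M.1 = 0 ∧ crossCount (U₁.1 ∪ U₂.1) M.1 = 0 ∧
        (M.1.filter fun e => Crosses (U₁.1 \ U₂.1) e ∧ Crosses (U₂.1 \ U₁.1) e).card = 1) ∨
      ((M.1.filter fun e => Crosses (U₁.1 \ U₂.1) e ∧ Crosses (U₂.1 \ U₁.1) e).card = 0 ∧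
        ((crossCount (U₁.1 ∩ U₂.1) M.1 = 0 ∧ crossCount (U₁.1 ∪ U₂.1) M.1 = 2) ∨
          (crossCount (U₁.1 ∩ U₂.1) M.1 = 2 ∧ crossCount (U₁.1 ∪ U₂.1) M.1 = 0))) := by
  obtain ⟨hi, hu⟩ := even_inter_union_of_odd_sdiff U₁ U₂ hs
  rw [cc_eq_crossCount] at h₁ h₂
  exact tight_tight_trichotomy M.2 (subset_univ _) (subset_univ _) hi hu h₁ h₂

/-- **Counted trichotomy at even Johnson distance, `K_n` currency.** For two odd cuts with `|U₁ ∖ U₂|` even and a perfect matching tight with both: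
either `M` splits along `U₁ ∖ U₂` and along `U₂ ∖ U₁` with exactly one edge joining `U₁ ∩ U₂` to the complement of `U₁ ∪ U₂`, or there is no such
edge and `(cc(U₁ ∖ U₂), cc(U₂ ∖ U₁)) ∈ {(0,2),(2,0)}`. [cite: Rothvoss2017, §2 (PDF p. 6: the tight pairs `Q_1`)] -/
theorem cc_trichotomy_even {U₁ U₂ : OddSet n} {M : PMatch n} (hs : Even (U₁.1 \ U₂.1).card) (h₁ : cc U₁ M = 1) (h₂ : cc U₂ M = 1) :
    (crossCount (U₁.1 \ U₂.1) M.1 = 0 ∧ crossCount (U₂.1 \ U₁.1) M.1 = 0 ∧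
        (M.1.filter fun e => Crosses (U₁.1 ∩ U₂.1) e ∧ Crosses (U₁.1 ∪ U₂.1) e).card = 1) ∨
      ((M.1.filter fun e => Crosses (U₁.1 ∩ U₂.1) e ∧ Crosses (U₁.1 ∪ U₂.1) e).card = 0 ∧
        ((crossCount (U₁.1 \ U₂.1) M.1 = 0 ∧ crossCount (U₂.1 \ U₁.1) M.1 = 2) ∨
          (crossCount (U₁.1 \ U₂.1) M.1 = 2 ∧ crossCount (U₂.1 \ U₁.1) M.1 = 0))) := by
  have hs₂ := even_sdiff_of_even_sdiff U₁ U₂ hs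
  rw [cc_eq_crossCount] at h₁ h₂
  exact tight_tight_trichotomy_even M.2 (subset_univ _) (subset_univ _) hs hs₂ h₁ h₂

end Trichotomy

end Summit.PneNP.PneNP.Theorems.ChebyshevTracialDesignCutPairLinks

end
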